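import Mathlib
import Literature.NumberTheory.Transcendental.Associators
import Literature.NumberTheory.Transcendental.MZVShuffleRegularisation
import HarnessLib

/-!
# The Drinfeld (KZ) associator `Φ_KZ` and Drinfeld's theorem that it satisfies the GT-relations

Named-fact file (Literature, `NumberTheory/Transcendental`). It records, in the vocabulary of
`Associators.lean` (`NCSeries`, `NCSeries.IsGroupLike`, `NCSeries.DrinfeldPentagon`,
`NCSeries.IsAssociatorPair`) and of `MZVShuffleRegularisation.lean` (`MZV.shuffleReg`, the
two-sided shuffle regularisation `reg : ℚ⟨x,y⟩ → 𝔥⁰`, `reg(x) = reg(y) = 0`):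

1. `drinfeldAssociator : NCSeries Bool ℝ` — the **Drinfeld associator** `Φ_KZ(X₀, X₁)`, the
   connection matrix `G₀ = G₁ · Φ_KZ` of the KZ equation `G'(u) = (X₀/u + X₁/(u-1)) G(u)`
   [Furusho2003, Def. 3.1.1; Drinfeld1991, §2], given COEFFICIENTWISE by the explicit formula of
   [Furusho2003, Prop. 3.2.3] (after [LeMurakami1996, Thm A.9]):
   `Φ_KZ = 1 + Σ_W I(W) W`, `I(W) = (-1)^{dp W} Z(reg W)`, where `dp W` is the number of letters
   `X₁` in `W`, `Z` is the `ℚ`-linear map sending a convergent word `X₀^{s₁-1}X₁ ⋯ X₀^{s_k-1}X₁`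
   to the iterated integral `∫₀¹ (du/u)^{s₁-1} ∘ du/(1-u) ∘ ⋯` "obtained by replacing `A = X₀` by
   `du/u` and `B = X₁` by `du/(1-u)`" [Furusho2003, §3.2], i.e. to `ζ(s₁,…,s_k)` in the tree's
   (decreasing) convention `multipleZeta [s₁,…,s_k]` (the word is `MZV.binaryWord [s₁,…,s_k]`,
   leftmost letter = outermost integration = largest summation variable, exactly as in
   `KZ.mzvIntegrand` / `KZ.mzvRep_value_eq`), and `reg` is the two-sided shuffle regularisation:
   Prop. 3.2.3 prints, for `W = B^r V A^s` (`V` convergent),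
   `I(W) = (-1)^{dp W} Σ_{0≤a≤r, 0≤b≤s} (-1)^{a+b} Z(f(B^a ш B^{r-a} V A^{s-b} ш A^b))` with `f` the
   projection killing words beginning with `B` or ending with `A` — the constant-term map of
   `𝔥 = 𝔥⁰[x,y]`, which is `MZV.shuffleReg` ([IharaKanekoZagier2006, §3, reg_ш at `T = 0`, Cor. 5]).
   In [Furusho2011, §1, (0.1)]: `Φ_KZ(X₀,X₁) = 1 + Σ (-1)^m ζ(k₁,…,k_m) X₀^{k_m-1}X₁ ⋯ X₀^{k₁-1}X₁
   + (regularized terms)` with `ζ(k₁,…,k_m) = Σ_{0<n₁<⋯<n_m} n₁^{-k₁}⋯n_m^{-k_m}` (increasing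
   convention; `= multipleZeta [k_m,…,k₁]`).
   Sanity theorems proved here from the tree's API: `c_∅ = 1`, `c_{X₀} = c_{X₁} = 0`,
   `c_{binaryWord s} = (-1)^{|s|} ζ(s)` for admissible `s`, and the weight-2 coefficients
   `c_{X₀X₁} = -ζ(2)`, `c_{X₁X₀} = +ζ(2)`, matching the printed expansion
   `Φ_KZ(A,B) = 1 - ζ(2)[A,B] - ζ(3)[A,[A,B]] + ζ(1,2)[[A,B],B] + ⋯` [Furusho2003, after Prop. 3.2.3].
2. NAMED FACTS (not proved here): `drinfeldAssociator_pentagon` — `Φ_KZ` satisfies Drinfeld's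
   pentagon equation [Drinfeld1991, (2.13); Furusho2003, Property II and Rem. 3.3.2;
   Furusho2011, §1 "It is shown in [Dr] that Φ_KZ satisfies GT-relations (with μ = 2πi)"];
   `drinfeldAssociator_isGroupLike` — `Φ_KZ` is group-like [Drinfeld1991; Furusho2003,
   Property II (0): `log Φ_KZ` is a Lie series]; `drinfeldAssociator_isAssociatorPair` — the pair
   `(2πi, Φ_KZ)` satisfies the GT-relations (group-like, pentagon, two hexagons) in
   `ℂ⟨⟨X₀,X₁⟩⟩` [Drinfeld1991; Furusho2011, §1].

These facts are the real-number ("evaluated") shadow of the rules-level crux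
`Summit.KontsevichZagierPeriods.KontsevichZagierPeriods.Theses.FurushoPentagon.PentagonInKZ`
(stmt-KontsevichZagierPeriods-4110: the rules associator `Φ_P` over the formal period ring
satisfies the pentagon; `KZ.eval` should map `Φ_P` coefficientwise to `drinfeldAssociator`) and of
the informal support `FurushoTransfer` (stmt-5054); combined with the tree's named fact
`furusho_pentagon_doubleShuffle` [Furusho2011, Thm 1.2] they give the regularised double shuffle
relations of real MZVs [IharaKanekoZagier2006, Thm 2; Racinet2002].

## Conventions (why the signs are as they are)

Furusho's KZ equation is `dG = (A/u + B/(u-1)) G du` and `Z` integrates `du/u`, `du/(1-u)`;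
since `du/(u-1) = -du/(1-u)`, each letter `B = X₁` contributes a sign, whence `(-1)^{dp W}`
[Furusho2003, Prop. 3.2.3, first bullet: "When `W` is in `M`, `I(W) = (-1)^{dp(W)} Z(W)`"].
Drinfeld's own `φ_KZ(A,B) = Φ_KZ(A/2πi, B/2πi)` [Furusho2003, footnote to Def. 3.1.1] satisfies the
same (homogeneous) pentagon. The alphabet dictionary `X₀ = false`, `X₁ = true` is that of
`Associators.lean` and `MZVSimplexRep.lean`.

## Deliberately NOT here

The analytic construction of `Φ_KZ` from the KZ equation (we take the printed coefficient formula
as the definition and cite the identification); any proof of the named facts; `GRT₁`, `DMR₀`.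

## References

* V. G. Drinfel'd, *On quasitriangular quasi-Hopf algebras and on a group that is closely connected
  with Gal(Q̄/Q)*, Leningrad Math. J. 2 (1991), 829–860, §2, (2.12), (2.13), §5, (5.3). [Drinfeld1991]
* H. Furusho, *The multiple zeta value algebra and the stable derivation algebra*, Publ. RIMS 39
  (2003), 695–720, §3.1 Def. 3.1.1, §3.2 Prop. 3.2.3, §3.3 Property II, Rem. 3.3.2
  (= §4.1–4.3, Prop. 4.2.3, Rem. 4.3.2 of arXiv:math/0011261, pp. 9–10). [Furusho2003]
* H. Furusho, *Double shuffle relation for associators*, Ann. of Math. 174 (2011), 341–360, §1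
  (arXiv:0808.0319, p. 3). [Furusho2011]
* T. Q. T. Le, J. Murakami, *Kontsevich's integral for the Kauffman polynomial*, Nagoya Math. J.
  142 (1996), 39–65, Thm A.9. [LeMurakami1996]
* K. Ihara, M. Kaneko, D. Zagier, *Derivation and double shuffle relations for multiple zeta
  values*, Compos. Math. 142 (2006), §3, Cor. 5. [IharaKanekoZagier2006]
-/

noncomputable section

open scoped BigOperators

namespace Literature.NumberTheory.Transcendental

namespace MZV

/-- The `ℚ`-linear evaluation `Z : 𝔥⁰ → ℝ`, `Σ_v a_v v ↦ Σ_v a_v ζ(v)`, a convergent word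
`v = x^{s₁-1}y⋯x^{s_k-1}y` being read as the index `MZV.ofBinaryWord v = [s₁,…,s_k]` and evaluated by
`multipleZeta` (Furusho's map `Z : M → ℂ`, "replace `A` by `du/u` and `B` by `du/(1-u)`", extended
linearly and with `Z(∅) = 1`). [cite: Furusho2003, §3.2 (the map Z)] -/
def zetaWordSum (f : List Bool →₀ ℚ) : ℝ :=
  f.sum fun v a => (a : ℝ) * multipleZeta (ofBinaryWord v)

/-- `Z` of a single word with coefficient `a` is `a ζ(word)`. [cite: Furusho2003, §3.2] -/
theorem zetaWordSum_single (v : List Bool) (a : ℚ) :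
    zetaWordSum (Finsupp.single v a) = (a : ℝ) * multipleZeta (ofBinaryWord v) := by
  unfold zetaWordSum
  rw [Finsupp.sum_single_index (by simp)]

/-- `Z(0) = 0`. [cite: Furusho2003, §3.2] -/
@[simp] theorem zetaWordSum_zero : zetaWordSum 0 = 0 := by
  simp [zetaWordSum]

/-- `Z(-f) = -Z(f)`. [cite: Furusho2003, §3.2] -/
theorem zetaWordSum_neg (f : List Bool →₀ ℚ) : zetaWordSum (-f) = -zetaWordSum f := by
  unfold zetaWordSum
  rw [Finsupp.sum_neg_index (by simp)]
  simp only [Rat.cast_neg, neg_mul, Finsupp.sum_neg]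

end MZV

open NCSeries

/-- **The Drinfeld associator** `Φ_KZ(X₀,X₁) ∈ ℝ⟨⟨X₀,X₁⟩⟩` (`X₀ = false`, `X₁ = true`), defined
coefficientwise by Furusho's explicit formula [Furusho2003, Prop. 3.2.3]:
`c_W(Φ_KZ) = I(W) = (-1)^{dp W} Z(reg W)`, `dp W` = number of letters `X₁` in `W`, `reg` = the
two-sided shuffle regularisation `MZV.shuffleReg` (constant-term map `𝔥 = 𝔥⁰[x,y] → 𝔥⁰`,
[IharaKanekoZagier2006, §3, Cor. 5]), `Z` = `MZV.zetaWordSum`. It is the connection matrix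
`G₀ = G₁ Φ_KZ` of `G'(u) = (X₀/u + X₁/(u-1))G(u)` [Furusho2003, Def. 3.1.1]; in [Furusho2011, §1]:
`Φ_KZ = 1 + Σ (-1)^m ζ(k₁,…,k_m) X₀^{k_m-1}X₁⋯X₀^{k₁-1}X₁ + (regularized terms)`.
[cite: Furusho2003, Prop. 3.2.3] -/
def drinfeldAssociator : NCSeries Bool ℝ := fun W =>
  (-1 : ℝ) ^ (W.count true) * MZV.zetaWordSum (MZV.shuffleReg W)

/-- Unfolding the definition at a word. [cite: Furusho2003, Prop. 3.2.3] -/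
theorem drinfeldAssociator_apply (W : List Bool) :
    drinfeldAssociator W = (-1 : ℝ) ^ (W.count true) * MZV.zetaWordSum (MZV.shuffleReg W) := rfl

/-- **Constant term `1`.** [cite: Furusho2003, Prop. 3.2.3 (Φ_KZ = 1 + Σ_W I(W) W)] -/
theorem drinfeldAssociator_nil : drinfeldAssociator [] = 1 := by
  rw [drinfeldAssociator_apply, MZV.shuffleReg_of_isConvergentWord (Or.inl rfl),
    MZV.zetaWordSum_single]
  simp [multipleZeta_nil]

/-- **`c_{X₀}(Φ_KZ) = 0`** (`reg(x) = 0`). [cite: Furusho2003, Prop. 3.2.3; Furusho2011, Thm 2.1 (c_{X₀}(φ) = c_{X₁}(φ) = 0)] -/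
theorem drinfeldAssociator_X₀ : drinfeldAssociator [false] = 0 := by
  rw [drinfeldAssociator_apply, MZV.shuffleReg_x]
  simp

/-- **`c_{X₁}(Φ_KZ) = 0`** (`reg(y) = 0`). [cite: Furusho2003, Prop. 3.2.3; Furusho2011, Thm 2.1] -/
theorem drinfeldAssociator_X₁ : drinfeldAssociator [true] = 0 := by
  rw [drinfeldAssociator_apply, MZV.shuffleReg_y]
  simp

/-- The number of letters `X₁` in `binaryWord s` is the depth `|s|`. [folklore] -/
theorem MZV.count_true_binaryWord : ∀ s : List ℕ, (MZV.binaryWord s).count true = s.length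
  | [] => rfl
  | a :: s => by
    rw [MZV.binaryWord, List.count_append, List.count_append, MZV.count_true_binaryWord s]
    simp [List.count_replicate]
    omega

/-- **Convergent coefficients are signed MZVs** [Furusho2003, Prop. 3.2.3, first bullet: "When `W`
is in `M`, `I(W) = (-1)^{dp(W)} Z(W)`"; Furusho2011, (0.1)]: for an admissible index `s`,
`c_{binaryWord s}(Φ_KZ) = (-1)^{|s|} ζ(s)` (tree convention `multipleZeta`, decreasing).
[cite: Furusho2003, Prop. 3.2.3] -/
theorem drinfeldAssociator_binaryWord {s : List ℕ} (hs : MZV.IsAdmissible s) :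
    drinfeldAssociator (MZV.binaryWord s) = (-1 : ℝ) ^ s.length * multipleZeta s := by
  have hconv : MZV.IsConvergentWord (MZV.binaryWord s) := by
    cases s with
    | nil => exact Or.inl rfl
    | cons a s =>
      exact Or.inr ⟨MZV.head?_binaryWord (hs.2 (List.cons_ne_nil a s)),
        MZV.getLast?_binaryWord (List.cons_ne_nil a s)⟩
  rw [drinfeldAssociator_apply, MZV.shuffleReg_of_isConvergentWord hconv, MZV.zetaWordSum_single,
    MZV.ofBinaryWord_binaryWord hs.1, MZV.count_true_binaryWord]
  simp

/-- **`c_{X₀X₁}(Φ_KZ) = -ζ(2)`**, the coefficient of `AB` in `1 - ζ(2)[A,B] + ⋯`.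
[cite: Furusho2003, after Prop. 3.2.3 (low-degree expansion)] -/
theorem drinfeldAssociator_X₀X₁ : drinfeldAssociator [false, true] = -multipleZeta [2] := by
  have h : MZV.binaryWord [2] = [false, true] := by simp [MZV.binaryWord]
  have hadm : MZV.IsAdmissible [2] := ⟨by simp, by simp⟩
  rw [← h, drinfeldAssociator_binaryWord hadm]
  simp

/-- **`c_{X₁X₀}(Φ_KZ) = +ζ(2)`**, the coefficient of `BA` in `1 - ζ(2)[A,B] + ⋯` — a genuinely
regularised coefficient: `reg(yx) = -xy` (`MZV.shuffleReg_yx`) and `dp = 1`.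
[cite: Furusho2003, Prop. 3.2.3 and the expansion after it] -/
theorem drinfeldAssociator_X₁X₀ : drinfeldAssociator [true, false] = multipleZeta [2] := by
  rw [drinfeldAssociator_apply, MZV.shuffleReg_yx, MZV.zetaWordSum_neg, MZV.zetaWordSum_single]
  have : MZV.ofBinaryWord [false, true] = [2] := by decide
  rw [this]
  simp

/-- **Drinfeld's theorem, pentagon part** [Drinfeld1991, (2.13)]: the Drinfeld associator satisfies
the pentagon equation
`Φ(t₁₂, t₂₃ + t₂₄) Φ(t₁₃ + t₂₃, t₃₄) = Φ(t₂₃, t₃₄) Φ(t₁₂ + t₁₃, t₂₄ + t₃₄) Φ(t₁₂, t₂₃)` in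
`U𝔞₄^∧ ⊗̂ ℝ` ([Furusho2003, Property II (III) and Rem. 3.3.2, (2.13)]; [Furusho2011, §1]: "It is
shown in [Dr] that `Φ_KZ` satisfies GT-relations (with `μ = 2πi`)"). Real-number shadow of
`Summit.KontsevichZagierPeriods.KontsevichZagierPeriods.Theses.FurushoPentagon.PentagonInKZ`.
Named fact (not proved here). [cite: Drinfeld1991, (2.13)] -/
def drinfeldAssociator_pentagon : Prop :=
  DrinfeldPentagon drinfeldAssociator

/-- **Drinfeld's theorem, group-likeness** [Drinfeld1991, §2]: `Φ_KZ` is group-like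
(`log Φ_KZ` is a Lie series: [Furusho2003, Property II (0)]); coefficientwise these are the
regularised shuffle relations `c_u c_v = Σ_{w ∈ u ш v} c_w` of multiple zeta values
[IharaKanekoZagier2006, Thm 1–2]. Named fact (not proved here). [cite: Drinfeld1991, §2] -/
def drinfeldAssociator_isGroupLike : Prop :=
  IsGroupLike drinfeldAssociator

/-- **Drinfeld's theorem (GT-relations)** [Drinfeld1991, (2.12), (2.13), (5.3)]: the pair
`(2πi, Φ_KZ)` satisfies the GT-relations — `Φ_KZ` is group-like, satisfies the pentagon, and
`(2πi, Φ_KZ)` satisfies the two hexagon equations — in `ℂ⟨⟨X₀, X₁⟩⟩` ([Furusho2011, §1]: "It is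
shown in [Dr] that `Φ_KZ` satisfies GT-relations (with `μ = 2πi`)"; `Φ_KZ` has real coefficients,
so `μ = -2πi` works as well, by complex conjugation). Named fact (not proved here).
[cite: Furusho2011, §1] -/
def drinfeldAssociator_isAssociatorPair : Prop :=
  IsAssociatorPair (2 * Real.pi * Complex.I : ℂ) (NCSeries.map (algebraMap ℝ ℂ) drinfeldAssociator)

end Literature.NumberTheory.Transcendental
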